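import Mathlib
import HarnessLib
import Summits.HubbardSuperconductivity.HubbardSuperconductivity.Theorems.KLProgrammeKLRegimeUVCovarianceMomentsAt
import Summits.HubbardSuperconductivity.HubbardSuperconductivity.Theorems.KLProgrammeKLRegimeUVCovarianceSpaceMomentAt
import Summits.HubbardSuperconductivity.HubbardSuperconductivity.Theorems.KLProgrammeKLRegimeEngineScaleZeroAlphaW
import Summits.HubbardSuperconductivity.HubbardSuperconductivity.Theorems.KLProgrammeKLRegimeEngineScaleZeroE4OverlapTime

/-!
# Route `KLProgramme` — crux K3, child 4 VL (stmt-HubbardSuperconductivity-20440), located risk #8 «(VL)-DEAD-LEG»: the covariance data of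
# the UV-dressed propagator `C^K_{>Λ}` at EVERY cutoff `0 < Λ ≤ klE0` — WEIGHTED rows and columns, the two-volume kit's `(1 + tnorm)` rows,
# and the far TAILS `≤ m₁/(R+1)`, on every time grid `N ≥ 2M`, uniform in `L` and `M`

Cell gate-hubbard-kl, seat hubbard-kl-k3c4-p2 g10 (pen rulings (R59t)(ii)/(R59u)/(R59aa); BGM 2006 (4.8b)).  Assembly of the three torus sums
of `…UVCovarianceMomentsAt` (mass `rowSum_/colSum_uvCov_le`, time moment `timeMoment_uvCov_of_frameOK`) and `…UVCovarianceSpaceMomentAt`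
(`spaceMoment_uvCov_of_frameOK`), transported to the grid legs by `HubbardGridCharactersWeighted.sum_norm_mul_gridSub_pullback_row/col_le_of_weight`
exactly as p3's scale-`0` packaging `EngineV8.rowSum_scaleZero_gridLabelWt_le` (which is the case `Λ = klE0`, `N = 4M`).  With
`G := (hubbardGridSub V M β N)ᵀ · hubbardCovAboveCT V M β μ 0 K Λ · hubbardGridSub V M β N`, `FrameOK R U N_sc μ K`, `R.WF`, `|U| ≤ 1`,
`klBetaMin ≤ β`, `β³ ≤ M`, `2M ≤ N`, cutoff derivatives `≤ B` up to order `5`, `0 < Λ ≤ klE0`: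

* **`rowSum_uvCov_gridLabelWt_le`** / **`colSum_uvCov_gridLabelWt_le`** — `Σ_Y ‖G X Y‖ · gridLabelWt V N β {pos X, pos Y} ≤ (N/β)·(A₀(Λ) + uvTimeMomentConst Λ 7 32 + 2·X_R(Λ))`
  (`gridLabelWt = 1 + (β/N)|Δt|_N + |Δx⃗|_{ℓ^∞}`; the engine's (E4)-type weight);
* (companion `…UVCovarianceTailsAt`) the two-volume kit's `(1 + tnorm)`-weighted rows/columns and the far TAILS `≤ (N/β)·(A₀ + 2X_R)/(R+1)`.

`A₀(Λ)`, `X_R(Λ)` are the closed expressions of the two companions (written out); the factor `N/β` is the inverse time weight of a grid point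
(the consumer's substitutions carry `ε = β/N`).  At `Λ = Λ_h = klScale klE0 h` use `UVCovarianceAt.klScale_admissible h`.  Everything is proved; no
definitions, no named facts.
-/

noncomputable section

namespace Summit.HubbardSuperconductivity.HubbardSuperconductivity.Theorems.UVCovarianceAt

set_option linter.dupNamespace false -- summit = problem name (single-conjunct summit), D-0017

open Real Finset Literature.MathematicalPhysics.QuantumLattice Literature.Probability.LatticeModels
open Literature.MathematicalPhysics.QuantumLattice.FermiRG
open Summit.HubbardSuperconductivity.HubbardSuperconductivity.Theorems.KLRegimeSplit
open Summit.HubbardSuperconductivity.HubbardSuperconductivity.Theorems.DispersionFlow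
open Summit.HubbardSuperconductivity.HubbardSuperconductivity.Theorems.ScaleZeroDecay
open Summit.HubbardSuperconductivity.HubbardSuperconductivity.Theorems.EngineV8

variable {L M N : ℕ} [NeZero L] [NeZero M] [NeZero N] {R : RenConsts} {U β μ Λ : ℝ} {Nsc : ℕ} {K : TrigPolyC4v} {B : ℝ}

/-! ## §1 The three partial weighted torus sums, transported to the grid legs -/

section Parts

omit [NeZero M] in
/-- **Time part, rows**: `Σ_Y ‖G X Y‖·(β/N)|j_X − j_Y|_N ≤ (N/β)·uvTimeMomentConst Λ 7 32`. -/
theorem rowSum_uvCov_timeWt_le (hK : FrameOK R U Nsc μ K) (hβ : klBetaMin ≤ β) (hβM : β ^ 3 ≤ (M : ℝ)) (hMN : 2 * M ≤ N) (hΛ : 0 < Λ)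
    (X : GridLeg (GridPoint L N)) :
    ∑ Y : GridLeg (GridPoint L N), ‖((hubbardGridSub L M β N).transpose * hubbardCovAboveCT L M β μ 0 K Λ * hubbardGridSub L M β N) X Y‖ *
        (β / N * cyclicDist N (((X.1.1.1 : ℕ) : ZMod N) - ((Y.1.1.1 : ℕ) : ZMod N)) 0) ≤ (N : ℝ) / β * uvTimeMomentConst Λ 7 32 := by
  have hβ0 : 0 < β := beta_pos_of_klBetaMin_le hβ
  have hNpos : 0 < (N : ℝ) := by exact_mod_cast Nat.pos_of_ne_zero (NeZero.ne N)
  have hTsum : ∀ σ : Fin 2, ∑ a : TorusSite 1 N, ∑ bv : TorusSite 2 L,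
      (β / N * cyclicDist N (a 0) 0) * ‖∑ q₀ : TorusSite 1 N, ∑ qv : TorusSite 2 L, torusChar q₀ a * torusChar qv bv *
        gridSymbol L M N β (uvSymbolCT L M β μ K Λ) σ q₀ qv‖ ≤ (N : ℝ) / β * uvTimeMomentConst Λ 7 32 := by
    intro σ
    have h := timeMoment_uvCov_of_frameOK (L := L) hK hβ hβM hMN hΛ (Rs := 32) (by norm_num) σ
    simp_rw [cyclicDist_zero_eq_abs_valMinAbs]
    rw [show (N : ℝ) / β * uvTimeMomentConst Λ 7 32 = (β / N)⁻¹ * uvTimeMomentConst Λ 7 32 by rw [inv_div]]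
    exact (le_inv_mul_iff₀ (by positivity)).2 h
  have h := sum_norm_mul_gridSub_pullback_row_le_of_weight (L := L) (M := M) (N := N) hβ0.ne' hMN (uvSymbolCT L M β μ K Λ)
    (fun a _ => β / N * cyclicDist N (a 0) 0) (fun a bv => by simp only [Pi.neg_apply, cyclicDist_neg_zero]) hTsum X
  rw [hubbardCovAboveCT_zero_seed_eq_normalCovariance_uvSymbolCT]
  simpa only using h

omit [NeZero M] in
/-- **Time part, columns.** -/
theorem colSum_uvCov_timeWt_le (hK : FrameOK R U Nsc μ K) (hβ : klBetaMin ≤ β) (hβM : β ^ 3 ≤ (M : ℝ)) (hMN : 2 * M ≤ N) (hΛ : 0 < Λ)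
    (Y : GridLeg (GridPoint L N)) :
    ∑ X : GridLeg (GridPoint L N), ‖((hubbardGridSub L M β N).transpose * hubbardCovAboveCT L M β μ 0 K Λ * hubbardGridSub L M β N) X Y‖ *
        (β / N * cyclicDist N (((X.1.1.1 : ℕ) : ZMod N) - ((Y.1.1.1 : ℕ) : ZMod N)) 0) ≤ (N : ℝ) / β * uvTimeMomentConst Λ 7 32 := by
  have hβ0 : 0 < β := beta_pos_of_klBetaMin_le hβ
  have hNpos : 0 < (N : ℝ) := by exact_mod_cast Nat.pos_of_ne_zero (NeZero.ne N)
  have hTsum : ∀ σ : Fin 2, ∑ a : TorusSite 1 N, ∑ bv : TorusSite 2 L,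
      (β / N * cyclicDist N (a 0) 0) * ‖∑ q₀ : TorusSite 1 N, ∑ qv : TorusSite 2 L, torusChar q₀ a * torusChar qv bv *
        gridSymbol L M N β (uvSymbolCT L M β μ K Λ) σ q₀ qv‖ ≤ (N : ℝ) / β * uvTimeMomentConst Λ 7 32 := by
    intro σ
    have h := timeMoment_uvCov_of_frameOK (L := L) hK hβ hβM hMN hΛ (Rs := 32) (by norm_num) σ
    simp_rw [cyclicDist_zero_eq_abs_valMinAbs]
    rw [show (N : ℝ) / β * uvTimeMomentConst Λ 7 32 = (β / N)⁻¹ * uvTimeMomentConst Λ 7 32 by rw [inv_div]]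
    exact (le_inv_mul_iff₀ (by positivity)).2 h
  have h := sum_norm_mul_gridSub_pullback_col_le_of_weight (L := L) (M := M) (N := N) hβ0.ne' hMN (uvSymbolCT L M β μ K Λ)
    (fun a _ => β / N * cyclicDist N (a 0) 0) (fun a bv => by simp only [Pi.neg_apply, cyclicDist_neg_zero]) hTsum Y
  rw [hubbardCovAboveCT_zero_seed_eq_normalCovariance_uvSymbolCT]
  simpa only using h

/-- The torus space-weighted sum from the two directional space moments:
`Σ_{a,b⃗} torusSiteDist(b⃗,0)·‖S[G_σ]‖ ≤ (N/β)·2·X_R(Λ)`. -/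
theorem torusSum_uvCov_spaceWt_le (hK : FrameOK R U Nsc μ K) (hR : R.WF) (hU1 : |U| ≤ 1) (hβ : klBetaMin ≤ β) (hβM : β ^ 3 ≤ (M : ℝ))
    (hMN : 2 * M ≤ N) (hB1 : 1 ≤ B) (hB : ∀ i ≤ 5, ∀ t, ‖iteratedDeriv i salmhoferCutoff t‖ ≤ B) (hΛ : 0 < Λ) (hΛe : Λ ≤ klE0) (σ : Fin 2) :
    ∑ a : TorusSite 1 N, ∑ bv : TorusSite 2 L,
        torusSiteDist bv 0 * ‖∑ q₀ : TorusSite 1 N, ∑ qv : TorusSite 2 L, torusChar q₀ a * torusChar qv bv *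
          gridSymbol L M N β (uvSymbolCT L M β μ K Λ) σ q₀ qv‖ ≤
      (N : ℝ) / β * (2 * (uvSpaceMomentConst Λ 1 (uvPieceSq Λ (uvBaseQ B Λ 4) (uvBaseQ' B Λ 4)) +
        (1 / 4 * Real.sqrt (216 * (1 / Λ + 1 / 2)) *
            ∑ e : Fin 2 × Fin 2, (uvLinV Λ (1 + (e.1 : ℕ) + (e.2 : ℕ)) *
                (B * ((1 + ((e.1 : ℕ) + (e.2 : ℕ)) + 2).factorial : ℝ) * (4 / Λ) ^ (1 + ((e.1 : ℕ) + (e.2 : ℕ)) + 1)) +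
              uvLinD Λ (1 + (e.1 : ℕ) + (e.2 : ℕ)) *
                (B * ((1 + ((e.1 : ℕ) + (e.2 : ℕ)) + 3).factorial : ℝ) * (4 / Λ) ^ (1 + ((e.1 : ℕ) + (e.2 : ℕ)) + 2)))) *
          (4608 * (1 + R.Gfr 0 + R.Gfr 1 + R.Gfr 2 + R.Gfr 3) ^ 4 * (((Nsc : ℝ) + 1) * U ^ 2 + 2 * |U|)))) := by
  have hβ0 : 0 < β := beta_pos_of_klBetaMin_le hβ
  have hNpos : 0 < (N : ℝ) := by exact_mod_cast Nat.pos_of_ne_zero (NeZero.ne N)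
  have hΛ4 : Λ ≤ 4 := hΛe.trans (by norm_num [klE0])
  set XR : ℝ := uvSpaceMomentConst Λ 1 (uvPieceSq Λ (uvBaseQ B Λ 4) (uvBaseQ' B Λ 4)) +
      (1 / 4 * Real.sqrt (216 * (1 / Λ + 1 / 2)) *
          ∑ e : Fin 2 × Fin 2, (uvLinV Λ (1 + (e.1 : ℕ) + (e.2 : ℕ)) *
              (B * ((1 + ((e.1 : ℕ) + (e.2 : ℕ)) + 2).factorial : ℝ) * (4 / Λ) ^ (1 + ((e.1 : ℕ) + (e.2 : ℕ)) + 1)) +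
            uvLinD Λ (1 + (e.1 : ℕ) + (e.2 : ℕ)) *
              (B * ((1 + ((e.1 : ℕ) + (e.2 : ℕ)) + 3).factorial : ℝ) * (4 / Λ) ^ (1 + ((e.1 : ℕ) + (e.2 : ℕ)) + 2)))) *
        (4608 * (1 + R.Gfr 0 + R.Gfr 1 + R.Gfr 2 + R.Gfr 3) ^ 4 * (((Nsc : ℝ) + 1) * U ^ 2 + 2 * |U|)) with hXR
  have h0 := spaceMoment_uvCov_of_frameOK (L := L) (N := N) hK hR hU1 hβ hβM hMN hB1 hB hΛ hΛ4 (l := 0) (l' := 1) (by decide) σ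
  have h1 := spaceMoment_uvCov_of_frameOK (L := L) (N := N) hK hR hU1 hβ hβM hMN hB1 hB hΛ hΛ4 (l := 1) (l' := 0) (by decide) σ
  rw [← hXR] at h0 h1
  have hsum : β / N * ∑ a : TorusSite 1 N, ∑ bv : TorusSite 2 L,
      (|(((bv 0).valMinAbs : ℤ) : ℝ)| + |(((bv 1).valMinAbs : ℤ) : ℝ)|) *
        ‖∑ q₀ : TorusSite 1 N, ∑ qv : TorusSite 2 L, torusChar q₀ a * torusChar qv bv *
          gridSymbol L M N β (uvSymbolCT L M β μ K Λ) σ q₀ qv‖ ≤ 2 * XR := by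
    have : β / N * ∑ a : TorusSite 1 N, ∑ bv : TorusSite 2 L,
        (|(((bv 0).valMinAbs : ℤ) : ℝ)| + |(((bv 1).valMinAbs : ℤ) : ℝ)|) *
          ‖∑ q₀ : TorusSite 1 N, ∑ qv : TorusSite 2 L, torusChar q₀ a * torusChar qv bv *
            gridSymbol L M N β (uvSymbolCT L M β μ K Λ) σ q₀ qv‖ =
        β / N * ∑ a : TorusSite 1 N, ∑ bv : TorusSite 2 L, |(((bv 0).valMinAbs : ℤ) : ℝ)| *
            ‖∑ q₀ : TorusSite 1 N, ∑ qv : TorusSite 2 L, torusChar q₀ a * torusChar qv bv *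
              gridSymbol L M N β (uvSymbolCT L M β μ K Λ) σ q₀ qv‖ +
          β / N * ∑ a : TorusSite 1 N, ∑ bv : TorusSite 2 L, |(((bv 1).valMinAbs : ℤ) : ℝ)| *
            ‖∑ q₀ : TorusSite 1 N, ∑ qv : TorusSite 2 L, torusChar q₀ a * torusChar qv bv *
              gridSymbol L M N β (uvSymbolCT L M β μ K Λ) σ q₀ qv‖ := by
      rw [← mul_add, ← sum_add_distrib]
      congr 1
      refine sum_congr rfl fun a _ => ?_
      rw [← sum_add_distrib]
      exact sum_congr rfl fun bv _ => by ring
    rw [this]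
    linarith
  have hle : ∑ a : TorusSite 1 N, ∑ bv : TorusSite 2 L,
      torusSiteDist bv 0 * ‖∑ q₀ : TorusSite 1 N, ∑ qv : TorusSite 2 L, torusChar q₀ a * torusChar qv bv *
        gridSymbol L M N β (uvSymbolCT L M β μ K Λ) σ q₀ qv‖ ≤
      ∑ a : TorusSite 1 N, ∑ bv : TorusSite 2 L, (|(((bv 0).valMinAbs : ℤ) : ℝ)| + |(((bv 1).valMinAbs : ℤ) : ℝ)|) *
        ‖∑ q₀ : TorusSite 1 N, ∑ qv : TorusSite 2 L, torusChar q₀ a * torusChar qv bv *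
          gridSymbol L M N β (uvSymbolCT L M β μ K Λ) σ q₀ qv‖ := by
    refine sum_le_sum fun a _ => sum_le_sum fun bv _ => mul_le_mul_of_nonneg_right ?_ (norm_nonneg _)
    have h := torusSiteDist_le_abs_add_abs bv 0
    rwa [sub_zero] at h
  calc _ ≤ _ := hle
    _ ≤ (β / N)⁻¹ * (2 * XR) := (le_inv_mul_iff₀ (by positivity)).2 hsum
    _ = (N : ℝ) / β * (2 * XR) := by rw [inv_div]

end Parts

/-! ## §2 The `gridLabelWt`-weighted rows and columns (the engine's (E4)-type weight) -/

section Wt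

/-- **`hrow ≤ α_w(Λ)`** — for an admissible frame and `0 < Λ ≤ klE0`:
`Σ_Y ‖G X Y‖·gridLabelWt {pos X, pos Y} ≤ (N/β)·(A₀(Λ) + uvTimeMomentConst Λ 7 32 + 2·X_R(Λ))` (plain + time + space). -/
theorem rowSum_uvCov_gridLabelWt_le (hK : FrameOK R U Nsc μ K) (hR : R.WF) (hU1 : |U| ≤ 1) (hβ : klBetaMin ≤ β) (hβM : β ^ 3 ≤ (M : ℝ))
    (hMN : 2 * M ≤ N) (hB1 : 1 ≤ B) (hB : ∀ i ≤ 5, ∀ t, ‖iteratedDeriv i salmhoferCutoff t‖ ≤ B) (hΛ : 0 < Λ) (hΛe : Λ ≤ klE0)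
    (X : GridLeg (GridPoint L N)) :
    ∑ Y : GridLeg (GridPoint L N),
        ‖((hubbardGridSub L M β N).transpose * hubbardCovAboveCT L M β μ 0 K Λ * hubbardGridSub L M β N) X Y‖ *
          gridLabelWt L N β {gridLegPos X, gridLegPos Y} ≤
      (N : ℝ) / β *
        (14 * Real.sqrt ((1 / 2 + 12 / Λ) *
            (2 / Λ + 128 * Real.pi ^ 4 * (4 * (1110 : ℝ) + 6 * (32 / 3) + 2) ^ 2 / Λ +
              2 * Real.pi ^ 5 * (4 * (1110 : ℝ) + 6 * (32 / 3) + 2) ^ 2 / Λ ^ 2 + 1 +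
              Real.pi ^ 4 * ((7 : ℝ) ^ 2 * (4 * (1110 : ℝ) + 6 * (32 / 3) + 2) * (2 / Λ) + 7 * (2 * (32 / 3) + 1)) ^ 2 / Λ ^ 3)) +
          uvTimeMomentConst Λ 7 32 +
          2 * (uvSpaceMomentConst Λ 1 (uvPieceSq Λ (uvBaseQ B Λ 4) (uvBaseQ' B Λ 4)) +
            (1 / 4 * Real.sqrt (216 * (1 / Λ + 1 / 2)) *
                ∑ e : Fin 2 × Fin 2, (uvLinV Λ (1 + (e.1 : ℕ) + (e.2 : ℕ)) *
                    (B * ((1 + ((e.1 : ℕ) + (e.2 : ℕ)) + 2).factorial : ℝ) * (4 / Λ) ^ (1 + ((e.1 : ℕ) + (e.2 : ℕ)) + 1)) +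
                  uvLinD Λ (1 + (e.1 : ℕ) + (e.2 : ℕ)) *
                    (B * ((1 + ((e.1 : ℕ) + (e.2 : ℕ)) + 3).factorial : ℝ) * (4 / Λ) ^ (1 + ((e.1 : ℕ) + (e.2 : ℕ)) + 2)))) *
              (4608 * (1 + R.Gfr 0 + R.Gfr 1 + R.Gfr 2 + R.Gfr 3) ^ 4 * (((Nsc : ℝ) + 1) * U ^ 2 + 2 * |U|)))) := by
  have hβ0 : 0 < β := beta_pos_of_klBetaMin_le hβ
  set A0 : ℝ := 14 * Real.sqrt ((1 / 2 + 12 / Λ) *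
            (2 / Λ + 128 * Real.pi ^ 4 * (4 * (1110 : ℝ) + 6 * (32 / 3) + 2) ^ 2 / Λ +
              2 * Real.pi ^ 5 * (4 * (1110 : ℝ) + 6 * (32 / 3) + 2) ^ 2 / Λ ^ 2 + 1 +
              Real.pi ^ 4 * ((7 : ℝ) ^ 2 * (4 * (1110 : ℝ) + 6 * (32 / 3) + 2) * (2 / Λ) + 7 * (2 * (32 / 3) + 1)) ^ 2 / Λ ^ 3)) with hA0
  set XR : ℝ := uvSpaceMomentConst Λ 1 (uvPieceSq Λ (uvBaseQ B Λ 4) (uvBaseQ' B Λ 4)) +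
            (1 / 4 * Real.sqrt (216 * (1 / Λ + 1 / 2)) *
                ∑ e : Fin 2 × Fin 2, (uvLinV Λ (1 + (e.1 : ℕ) + (e.2 : ℕ)) *
                    (B * ((1 + ((e.1 : ℕ) + (e.2 : ℕ)) + 2).factorial : ℝ) * (4 / Λ) ^ (1 + ((e.1 : ℕ) + (e.2 : ℕ)) + 1)) +
                  uvLinD Λ (1 + (e.1 : ℕ) + (e.2 : ℕ)) *
                    (B * ((1 + ((e.1 : ℕ) + (e.2 : ℕ)) + 3).factorial : ℝ) * (4 / Λ) ^ (1 + ((e.1 : ℕ) + (e.2 : ℕ)) + 2)))) *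
              (4608 * (1 + R.Gfr 0 + R.Gfr 1 + R.Gfr 2 + R.Gfr 3) ^ 4 * (((Nsc : ℝ) + 1) * U ^ 2 + 2 * |U|)) with hXR
  set G := (hubbardGridSub L M β N).transpose * hubbardCovAboveCT L M β μ 0 K Λ * hubbardGridSub L M β N with hGdef
  have hplain : ∑ Y : GridLeg (GridPoint L N), ‖G X Y‖ ≤ (N : ℝ) / β * A0 := rowSum_uvCov_le (L := L) hK hβ hβM hΛ hΛe hMN X
  have htime : ∑ Y : GridLeg (GridPoint L N), ‖G X Y‖ * (β / N * cyclicDist N (((X.1.1.1 : ℕ) : ZMod N) - ((Y.1.1.1 : ℕ) : ZMod N)) 0) ≤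
      (N : ℝ) / β * uvTimeMomentConst Λ 7 32 := rowSum_uvCov_timeWt_le (L := L) hK hβ hβM hMN hΛ X
  have hXsum : ∀ σ : Fin 2, ∑ a : TorusSite 1 N, ∑ bv : TorusSite 2 L,
      torusSiteDist bv 0 * ‖∑ q₀ : TorusSite 1 N, ∑ qv : TorusSite 2 L, torusChar q₀ a * torusChar qv bv *
        gridSymbol L M N β (uvSymbolCT L M β μ K Λ) σ q₀ qv‖ ≤ (N : ℝ) / β * (2 * XR) :=
    torusSum_uvCov_spaceWt_le (L := L) hK hR hU1 hβ hβM hMN hB1 hB hΛ hΛe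
  have hspace : ∑ Y : GridLeg (GridPoint L N), ‖G X Y‖ * torusSiteDist (X.1.1.2 - Y.1.1.2) 0 ≤ (N : ℝ) / β * (2 * XR) := by
    have h := sum_norm_mul_gridSub_pullback_row_le_of_weight (L := L) (M := M) (N := N) hβ0.ne' hMN (uvSymbolCT L M β μ K Λ)
      (fun _ bv => torusSiteDist bv 0) (fun a bv => by simp only [torusSiteDist_neg_zero]) hXsum X
    rw [hGdef, hubbardCovAboveCT_zero_seed_eq_normalCovariance_uvSymbolCT]
    simpa only using h
  have hsplit : ∀ Y : GridLeg (GridPoint L N), ‖G X Y‖ * gridLabelWt L N β {gridLegPos X, gridLegPos Y} =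
      ‖G X Y‖ + ‖G X Y‖ * (β / N * cyclicDist N (((X.1.1.1 : ℕ) : ZMod N) - ((Y.1.1.1 : ℕ) : ZMod N)) 0) +
        ‖G X Y‖ * torusSiteDist (X.1.1.2 - Y.1.1.2) 0 := by
    intro Y
    rw [gridLabelWt_legPair_eq_split hβ0.le X Y]
    ring
  rw [sum_congr rfl fun Y _ => hsplit Y, sum_add_distrib, sum_add_distrib, mul_add, mul_add]
  exact add_le_add (add_le_add hplain htime) hspace

/-- **`hcol ≤ α_w(Λ)`** — the same bound for the weighted column sums. -/
theorem colSum_uvCov_gridLabelWt_le (hK : FrameOK R U Nsc μ K) (hR : R.WF) (hU1 : |U| ≤ 1) (hβ : klBetaMin ≤ β) (hβM : β ^ 3 ≤ (M : ℝ))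
    (hMN : 2 * M ≤ N) (hB1 : 1 ≤ B) (hB : ∀ i ≤ 5, ∀ t, ‖iteratedDeriv i salmhoferCutoff t‖ ≤ B) (hΛ : 0 < Λ) (hΛe : Λ ≤ klE0)
    (Y : GridLeg (GridPoint L N)) :
    ∑ X : GridLeg (GridPoint L N),
        ‖((hubbardGridSub L M β N).transpose * hubbardCovAboveCT L M β μ 0 K Λ * hubbardGridSub L M β N) X Y‖ *
          gridLabelWt L N β {gridLegPos X, gridLegPos Y} ≤
      (N : ℝ) / β *
        (14 * Real.sqrt ((1 / 2 + 12 / Λ) *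
            (2 / Λ + 128 * Real.pi ^ 4 * (4 * (1110 : ℝ) + 6 * (32 / 3) + 2) ^ 2 / Λ +
              2 * Real.pi ^ 5 * (4 * (1110 : ℝ) + 6 * (32 / 3) + 2) ^ 2 / Λ ^ 2 + 1 +
              Real.pi ^ 4 * ((7 : ℝ) ^ 2 * (4 * (1110 : ℝ) + 6 * (32 / 3) + 2) * (2 / Λ) + 7 * (2 * (32 / 3) + 1)) ^ 2 / Λ ^ 3)) +
          uvTimeMomentConst Λ 7 32 +
          2 * (uvSpaceMomentConst Λ 1 (uvPieceSq Λ (uvBaseQ B Λ 4) (uvBaseQ' B Λ 4)) +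
            (1 / 4 * Real.sqrt (216 * (1 / Λ + 1 / 2)) *
                ∑ e : Fin 2 × Fin 2, (uvLinV Λ (1 + (e.1 : ℕ) + (e.2 : ℕ)) *
                    (B * ((1 + ((e.1 : ℕ) + (e.2 : ℕ)) + 2).factorial : ℝ) * (4 / Λ) ^ (1 + ((e.1 : ℕ) + (e.2 : ℕ)) + 1)) +
                  uvLinD Λ (1 + (e.1 : ℕ) + (e.2 : ℕ)) *
                    (B * ((1 + ((e.1 : ℕ) + (e.2 : ℕ)) + 3).factorial : ℝ) * (4 / Λ) ^ (1 + ((e.1 : ℕ) + (e.2 : ℕ)) + 2)))) *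
              (4608 * (1 + R.Gfr 0 + R.Gfr 1 + R.Gfr 2 + R.Gfr 3) ^ 4 * (((Nsc : ℝ) + 1) * U ^ 2 + 2 * |U|)))) := by
  have hβ0 : 0 < β := beta_pos_of_klBetaMin_le hβ
  set A0 : ℝ := 14 * Real.sqrt ((1 / 2 + 12 / Λ) *
            (2 / Λ + 128 * Real.pi ^ 4 * (4 * (1110 : ℝ) + 6 * (32 / 3) + 2) ^ 2 / Λ +
              2 * Real.pi ^ 5 * (4 * (1110 : ℝ) + 6 * (32 / 3) + 2) ^ 2 / Λ ^ 2 + 1 +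
              Real.pi ^ 4 * ((7 : ℝ) ^ 2 * (4 * (1110 : ℝ) + 6 * (32 / 3) + 2) * (2 / Λ) + 7 * (2 * (32 / 3) + 1)) ^ 2 / Λ ^ 3)) with hA0
  set XR : ℝ := uvSpaceMomentConst Λ 1 (uvPieceSq Λ (uvBaseQ B Λ 4) (uvBaseQ' B Λ 4)) +
            (1 / 4 * Real.sqrt (216 * (1 / Λ + 1 / 2)) *
                ∑ e : Fin 2 × Fin 2, (uvLinV Λ (1 + (e.1 : ℕ) + (e.2 : ℕ)) *
                    (B * ((1 + ((e.1 : ℕ) + (e.2 : ℕ)) + 2).factorial : ℝ) * (4 / Λ) ^ (1 + ((e.1 : ℕ) + (e.2 : ℕ)) + 1)) +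
                  uvLinD Λ (1 + (e.1 : ℕ) + (e.2 : ℕ)) *
                    (B * ((1 + ((e.1 : ℕ) + (e.2 : ℕ)) + 3).factorial : ℝ) * (4 / Λ) ^ (1 + ((e.1 : ℕ) + (e.2 : ℕ)) + 2)))) *
              (4608 * (1 + R.Gfr 0 + R.Gfr 1 + R.Gfr 2 + R.Gfr 3) ^ 4 * (((Nsc : ℝ) + 1) * U ^ 2 + 2 * |U|)) with hXR
  set G := (hubbardGridSub L M β N).transpose * hubbardCovAboveCT L M β μ 0 K Λ * hubbardGridSub L M β N with hGdef
  have hplain : ∑ X : GridLeg (GridPoint L N), ‖G X Y‖ ≤ (N : ℝ) / β * A0 := colSum_uvCov_le (L := L) hK hβ hβM hΛ hΛe hMN Y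
  have htime : ∑ X : GridLeg (GridPoint L N), ‖G X Y‖ * (β / N * cyclicDist N (((X.1.1.1 : ℕ) : ZMod N) - ((Y.1.1.1 : ℕ) : ZMod N)) 0) ≤
      (N : ℝ) / β * uvTimeMomentConst Λ 7 32 := colSum_uvCov_timeWt_le (L := L) hK hβ hβM hMN hΛ Y
  have hXsum : ∀ σ : Fin 2, ∑ a : TorusSite 1 N, ∑ bv : TorusSite 2 L,
      torusSiteDist bv 0 * ‖∑ q₀ : TorusSite 1 N, ∑ qv : TorusSite 2 L, torusChar q₀ a * torusChar qv bv *
        gridSymbol L M N β (uvSymbolCT L M β μ K Λ) σ q₀ qv‖ ≤ (N : ℝ) / β * (2 * XR) :=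
    torusSum_uvCov_spaceWt_le (L := L) hK hR hU1 hβ hβM hMN hB1 hB hΛ hΛe
  have hspace : ∑ X : GridLeg (GridPoint L N), ‖G X Y‖ * torusSiteDist (X.1.1.2 - Y.1.1.2) 0 ≤ (N : ℝ) / β * (2 * XR) := by
    have h := sum_norm_mul_gridSub_pullback_col_le_of_weight (L := L) (M := M) (N := N) hβ0.ne' hMN (uvSymbolCT L M β μ K Λ)
      (fun _ bv => torusSiteDist bv 0) (fun a bv => by simp only [torusSiteDist_neg_zero]) hXsum Y
    rw [hGdef, hubbardCovAboveCT_zero_seed_eq_normalCovariance_uvSymbolCT]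
    simpa only using h
  have hsplit : ∀ X : GridLeg (GridPoint L N), ‖G X Y‖ * gridLabelWt L N β {gridLegPos X, gridLegPos Y} =
      ‖G X Y‖ + ‖G X Y‖ * (β / N * cyclicDist N (((X.1.1.1 : ℕ) : ZMod N) - ((Y.1.1.1 : ℕ) : ZMod N)) 0) +
        ‖G X Y‖ * torusSiteDist (X.1.1.2 - Y.1.1.2) 0 := by
    intro X
    rw [gridLabelWt_legPair_eq_split hβ0.le X Y]
    ring
  rw [sum_congr rfl fun X _ => hsplit X, sum_add_distrib, sum_add_distrib, mul_add, mul_add]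
  exact add_le_add (add_le_add hplain htime) hspace

end Wt

end Summit.HubbardSuperconductivity.HubbardSuperconductivity.Theorems.UVCovarianceAt

end
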